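import Mathlib
import Literature.Computability.AlgebraicComplexity.GrenetEquivariant
import Literature.Computability.AlgebraicComplexity.EquivariantDC
import Literature.Computability.AlgebraicComplexity.DetReprEquivalent
import Literature.Computability.AlgebraicComplexity.ApolarityFischerPairing

/-!
# `OrbitDimensionBound` (stmt-ValiantsHypothesis-16133), rung line `sign_covering` — linear algebra for `stub_signDiagonalise`

Preliminaries (theorem-only, no definitions) for `Theorems/FreeSubtorusOrbitDimensionBoundStubSignDiagonalise.lean`,
which proves the registered stub `stub_signDiagonalise` of the line `Cruxes/OrbitDimensionBound/Lines/sign_covering.lean`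
(route `FreeSubtorus`, rung `Torsion.SignShadow`):

* §1–§2 **joint `±1`-eigenbasis of commuting involutions** (`exists_jointSignBasis`): for matrices `M_k ∈ GL_m(ℂ)` with
  `M_k² = 1` and `M_k M_l = M_l M_k` there are mutually inverse `P, P'` and signs `χ_i(k) = ±1` with
  `M_k = P · diag(χ_·(k)) · P'` — Mathlib's simultaneous triangularisation
  `Module.End.iSup_iInf_maxGenEigenspace_eq_top_of_iSup_maxGenEigenspace_eq_top_of_commute` plus «an involution is
  semisimple (`X² − 1` squarefree), so generalised eigenvectors are eigenvectors», a basis extracted from the spanning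
  set of joint eigenvectors (`exists_linearIndependent`), packaged with `Basis.toMatrix`;
* §3 **characters of a sign group are linear functionals** (`exists_functional_of_character`): a `±1`-valued
  multiplicative function on the subspace `S = {s ∈ 𝔽₂^X | L s = 0}` is `s ↦ (-1)^{⟨β, s⟩}` for some `β ∈ 𝔽₂^X`
  (`𝔽₂`-linearity of `S → 𝔽₂`, `LinearMap.exists_extend`, dual vector read off the standard basis);
* §4 **transport of a lift equation through a constant base change** (`linSubst_conj_entry`): if
  `B(γ·x) = (P D₁ P') · B · (Q D₂ Q')` with `P'P = 1 = Q'Q` then `B' = P' B Q` satisfies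
  `B'(γ·x)_{ij} = (D₁)_i (D₂)_j B'_{ij}` (tree `Matrix.linSubstEntries_mul` / `_map_C`).

Helper mode (`--supports stmt-ValiantsHypothesis-16133 --as helper`).  Honest framing: [folklore] linear algebra; the
crux `OrbitDimensionBound`, the route `FreeSubtorus` and VP ≠ VNP are OPEN and NOT moved by this file.

## References
* A. Borel, *Linear Algebraic Groups*, 2nd ed., GTM 126 (1991), §4.2, Prop. 4.6 (commuting semisimple families are
  simultaneously diagonalisable).
* [LandsbergRessayre2017] J. M. Landsberg, N. Ressayre, *Permanent v. determinant: an exponential lower bound assuming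
  symmetry and a potential path towards Valiant's conjecture*, Differential Geom. Appl. 55 (2017), §6.
-/

set_option linter.dupNamespace false

namespace Summit.ValiantsHypothesis.ValiantsHypothesis.Theorems.FreeSubtorusOrbitDimensionBound.SignCovering

open Matrix MvPolynomial
open Literature.Computability.AlgebraicComplexity

/-! ### §1 Involutions: generalised eigenvectors are eigenvectors -/

section Involutions

variable {V : Type*} [AddCommGroup V] [Module ℂ V]

/-- An involution is a semisimple endomorphism (`X² − 1` is squarefree in characteristic `0`). [folklore] -/
theorem isSemisimple_of_mul_self_eq_one (f : Module.End ℂ V) (hf : f * f = 1) : f.IsSemisimple := by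
  have hsq : Squarefree (Polynomial.X ^ 2 - Polynomial.C (1 : ℂ) : Polynomial ℂ) :=
    (Polynomial.separable_X_pow_sub_C (1 : ℂ) (by norm_num) one_ne_zero).squarefree
  refine Module.End.isSemisimple_of_squarefree_aeval_eq_zero hsq ?_
  simp [sq, hf]

/-- For an involution, every generalised eigenvector is an eigenvector. [folklore] -/
theorem apply_eq_smul_of_mem_maxGenEigenspace (f : Module.End ℂ V) (hf : f * f = 1) {μ : ℂ} {v : V}
    (hv : v ∈ f.maxGenEigenspace μ) : f v = μ • v := by
  have h := (isSemisimple_of_mul_self_eq_one f hf).isFinitelySemisimple.maxGenEigenspace_eq_eigenspace μ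
  rw [h] at hv
  exact Module.End.mem_eigenspace_iff.mp hv

end Involutions

/-! ### §2 A joint `±1`-eigenbasis for a commuting family of involutions, as a `GL` base change -/

section JointEigenbasis

variable {m : ℕ} {ι : Type*}

/-- **Joint eigenbasis of commuting involutions, matrix form.**  For a family of matrices `M k ∈ GL_m(ℂ)` with
`M k * M k = 1` and `M k * M l = M l * M k` there are mutually inverse matrices `P, P'` and signs
`χ i k ∈ {1, -1}` with `M k = P * diagonal (χ · k) * P'` for every `k`. [folklore] -/
theorem exists_jointSignBasis (M : ι → Matrix (Fin m) (Fin m) ℂ)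
    (hsq : ∀ k, M k * M k = 1) (hcomm : ∀ k l, M k * M l = M l * M k) :
    ∃ (P P' : Matrix (Fin m) (Fin m) ℂ) (χ : Fin m → ι → ℂ),
      P * P' = 1 ∧ P' * P = 1 ∧ (∀ i k, χ i k = 1 ∨ χ i k = -1) ∧
      ∀ k, M k = P * Matrix.diagonal (fun i => χ i k) * P' := by
  classical
  -- the commuting family of endomorphisms of `V = Fin m → ℂ`
  set f : ι → Module.End ℂ (Fin m → ℂ) := fun k => Matrix.toLin' (M k) with hf
  have hfsq : ∀ k, f k * f k = 1 := fun k => by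
    simp only [hf, Module.End.mul_eq_comp, ← Matrix.toLin'_mul, hsq, Matrix.toLin'_one]
    rfl
  have hfcomm : Pairwise fun k l => Commute (f k) (f l) := fun k l _ => by
    change f k * f l = f l * f k
    simp only [hf, Module.End.mul_eq_comp, ← Matrix.toLin'_mul, hcomm k l]
  -- joint generalised eigenspaces exhaust `V`; for involutions they are joint eigenspaces
  have htop := Module.End.iSup_iInf_maxGenEigenspace_eq_top_of_iSup_maxGenEigenspace_eq_top_of_commute f hfcomm
    (fun k => Module.End.iSup_maxGenEigenspace_eq_top (f k))
  -- the set of joint eigenvectors spans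
  set T : Set (Fin m → ℂ) := {w | ∃ χ : ι → ℂ, ∀ k, f k w = χ k • w} with hT
  have hspan : Submodule.span ℂ T = ⊤ := by
    rw [eq_top_iff, ← htop]
    refine iSup_le fun χ => ?_
    intro w hw
    refine Submodule.subset_span ⟨χ, fun k => ?_⟩
    exact apply_eq_smul_of_mem_maxGenEigenspace (f k) (hfsq k) ((Submodule.mem_iInf _).1 hw k)
  -- a basis inside `T`
  obtain ⟨b, hbT, hbspan, hbli⟩ := exists_linearIndependent ℂ T
  rw [hspan] at hbspan
  have hbfin : b.Finite := LinearIndependent.set_finite_of_isNoetherian hbli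
  letI : Fintype b := hbfin.fintype
  let bas : Module.Basis b ℂ (Fin m → ℂ) := Module.Basis.mk hbli (by rw [Subtype.range_coe_subtype, Set.setOf_mem_eq, hbspan])
  have hcard : Fintype.card b = m := by
    have h1 := Module.finrank_eq_card_basis bas
    rw [Module.finrank_pi, Fintype.card_fin] at h1
    exact h1.symm
  let e : b ≃ Fin m := Fintype.equivFinOfCardEq hcard
  let bas' : Module.Basis (Fin m) ℂ (Fin m → ℂ) := bas.reindex e
  have hbas'T : ∀ i, bas' i ∈ T := fun i => by
    have : bas' i = ((e.symm i : b) : Fin m → ℂ) := by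
      simp [bas', bas, Module.Basis.reindex_apply, Module.Basis.mk_apply]
    rw [this]
    exact hbT (e.symm i).2
  choose χ hχ using hbas'T
  -- the base-change matrices
  let std := Pi.basisFun ℂ (Fin m)
  refine ⟨std.toMatrix bas', bas'.toMatrix std, χ, std.toMatrix_mul_toMatrix_flip bas',
    bas'.toMatrix_mul_toMatrix_flip std, ?_, ?_⟩
  · -- signs
    intro i k
    have hv : bas' i ≠ 0 := bas'.ne_zero i
    have h2 : f k (f k (bas' i)) = bas' i := by
      rw [← Module.End.mul_apply, hfsq k, Module.End.one_apply]
    rw [hχ i k, map_smul, hχ i k, smul_smul] at h2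
    have h3 : (χ i k * χ i k - 1) • bas' i = 0 := by rw [sub_smul, one_smul, h2, sub_self]
    rcases smul_eq_zero.mp h3 with h | h
    · have : (χ i k - 1) * (χ i k + 1) = 0 := by ring_nf; linear_combination h
      rcases mul_eq_zero.mp this with h' | h'
      · exact Or.inl (by linear_combination h')
      · exact Or.inr (by linear_combination h')
    · exact absurd h hv
  · -- the conjugation formula, checked on columns
    intro k
    have key : M k * std.toMatrix bas' = std.toMatrix bas' * Matrix.diagonal (fun i => χ i k) := by
      ext a i
      rw [Matrix.mul_diagonal, Matrix.mul_apply]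
      have hcol : ∀ l, std.toMatrix bas' l i = bas' i l := fun l => by
        simp [std, Module.Basis.toMatrix_apply, Pi.basisFun_repr]
      simp_rw [hcol]
      have := congr_fun (hχ i k) a
      simp only [hf, Matrix.toLin'_apply, Matrix.mulVec, dotProduct, Pi.smul_apply, smul_eq_mul] at this
      rw [this, mul_comm]
    calc M k = M k * (std.toMatrix bas' * bas'.toMatrix std) := by
          rw [std.toMatrix_mul_toMatrix_flip bas', mul_one]
      _ = std.toMatrix bas' * Matrix.diagonal (fun i => χ i k) * bas'.toMatrix std := by
          rw [← Matrix.mul_assoc, key]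

end JointEigenbasis


/-! ### §3 Characters of a sign group `S_Λ ≤ 𝔽₂^X` come from linear functionals -/

section Characters

variable {X : Type*} [Fintype X] [DecidableEq X] {r : ℕ}

/-- The sign `(-1)^a` as a character of `𝔽₂`: `(-1)^(a+b) = (-1)^a (-1)^b`. [folklore] -/
theorem sgn_add (a b : ZMod 2) :
    (if a + b = 0 then (1 : ℂ) else -1) = (if a = 0 then (1 : ℂ) else -1) * (if b = 0 then (1 : ℂ) else -1) := by
  have hc : ∀ c : ZMod 2, c = 0 ∨ c = 1 := by decide
  have h11 : (1 : ZMod 2) + 1 = 0 := by decide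
  rcases hc a with rfl | rfl <;> rcases hc b with rfl | rfl <;> simp [h11]

/-- `(-1)^a ≠ 0`. [folklore] -/
theorem sgn_ne_zero (a : ZMod 2) : (if a = 0 then (1 : ℂ) else -1) ≠ 0 := by
  split_ifs <;> norm_num

/-- `(-1)^a = 1 ↔ a = 0`. [folklore] -/
theorem sgn_eq_one_iff (a : ZMod 2) : (if a = 0 then (1 : ℂ) else -1) = 1 ↔ a = 0 := by
  constructor
  · intro h
    by_contra ha
    rw [if_neg ha] at h
    norm_num at h
  · intro h
    rw [if_pos h]

/-- `a ↦ (-1)^a` is injective on `𝔽₂`. [folklore] -/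
theorem sgn_inj {a b : ZMod 2} (h : (if a = 0 then (1 : ℂ) else -1) = (if b = 0 then (1 : ℂ) else -1)) :
    a = b := by
  have hbb : ∀ c : ZMod 2, c + c = 0 := by decide
  have hb : b + b = 0 := hbb b
  have hab : (if a + b = 0 then (1 : ℂ) else -1) = 1 := by
    rw [sgn_add, h, ← sgn_add, if_pos hb]
  have hab' := (sgn_eq_one_iff _).mp hab
  have : a = a + b + b := by rw [add_assoc, hb, add_zero]
  rw [this, hab', zero_add]

/-- **Characters of the sign group extend to linear functionals.**  Let `S = {s : X → 𝔽₂ | ∀ i, Σ_x L i x · s x = 0}`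
(a subspace) and let `χ : (X → 𝔽₂) → ℂ` be multiplicative on `S` with values `±1` on `S`.  Then there is
`β : X → 𝔽₂` with `χ s = (-1)^{Σ_x β x · s x}` for every `s ∈ S` (a group homomorphism `S → {±1} ≅ 𝔽₂` is an
`𝔽₂`-linear functional on `S`, which extends to `𝔽₂^X`, whose dual is `𝔽₂^X` itself). [folklore] -/
theorem exists_functional_of_character (L : Fin r → X → ZMod 2) (χ : (X → ZMod 2) → ℂ)
    (hmul : ∀ s, (∀ i, ∑ x, L i x * s x = 0) → ∀ t, (∀ i, ∑ x, L i x * t x = 0) → χ (s + t) = χ s * χ t)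
    (hval : ∀ s, (∀ i, ∑ x, L i x * s x = 0) → χ s = 1 ∨ χ s = -1) :
    ∃ β : X → ZMod 2, ∀ s, (∀ i, ∑ x, L i x * s x = 0) →
      χ s = if (∑ x, β x * s x) = 0 then (1 : ℂ) else -1 := by
  classical
  -- the sign group as a subspace of `𝔽₂^X`
  let W : Submodule (ZMod 2) (X → ZMod 2) :=
    { carrier := {s | ∀ i, ∑ x, L i x * s x = 0}
      add_mem' := by
        intro s t hs ht i
        simp only [Set.mem_setOf_eq] at hs ht ⊢
        simp only [Pi.add_apply, mul_add, Finset.sum_add_distrib, hs i, ht i, add_zero]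
      zero_mem' := by
        intro i
        simp
      smul_mem' := by
        intro c s hs i
        simp only [Set.mem_setOf_eq] at hs ⊢
        simp only [Pi.smul_apply, smul_eq_mul, mul_left_comm (L i _) c, ← Finset.mul_sum, hs i, mul_zero] }
  have hW : ∀ s, s ∈ W ↔ ∀ i, ∑ x, L i x * s x = 0 := fun s => Iff.rfl
  have hone : (1 : ℂ) ≠ -1 := by norm_num
  have hχ0 : χ 0 = 1 := by
    have h0 : ∀ i, ∑ x, L i x * (0 : X → ZMod 2) x = 0 := fun i => by simp
    have h := hmul 0 h0 0 h0
    rw [add_zero] at h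
    rcases hval 0 h0 with h1 | h1
    · exact h1
    · exfalso
      rw [h1] at h
      norm_num at h
  -- the additive character as an `𝔽₂`-valued function on `W`
  let φ₀ : W → ZMod 2 := fun s => if χ (s : X → ZMod 2) = 1 then 0 else 1
  have hφ₀ : ∀ s : W, χ (s : X → ZMod 2) = if φ₀ s = 0 then (1 : ℂ) else -1 := by
    intro s
    simp only [φ₀]
    by_cases h : χ (s : X → ZMod 2) = 1
    · simp [h]
    · rcases hval s ((hW s).mp s.2) with h1 | h1
      · exact absurd h1 h
      · simp only [h1]
        norm_num
  have hφ₀_add : ∀ s t : W, φ₀ (s + t) = φ₀ s + φ₀ t := by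
    intro s t
    apply sgn_inj
    rw [sgn_add, ← hφ₀ s, ← hφ₀ t, ← hφ₀ (s + t)]
    exact hmul s ((hW s).mp s.2) t ((hW t).mp t.2)
  -- it is `𝔽₂`-linear
  let φ : W →ₗ[ZMod 2] ZMod 2 :=
    { toFun := φ₀
      map_add' := hφ₀_add
      map_smul' := by
        intro c s
        have h00 : φ₀ 0 = 0 := by
          have := hφ₀_add 0 0
          rw [add_zero] at this
          -- φ₀ 0 = φ₀ 0 + φ₀ 0 in 𝔽₂ forces φ₀ 0 = 0
          have h2 : ∀ a : ZMod 2, a = a + a → a = 0 := by decide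
          exact h2 _ this
        have hc : ∀ c : ZMod 2, c = 0 ∨ c = 1 := by decide
        rcases hc c with rfl | rfl
        · simp [h00]
        · simp }
  -- extend to `𝔽₂^X` and read off the dual vector
  obtain ⟨g, hg⟩ := LinearMap.exists_extend φ
  refine ⟨fun x => g (fun y => if x = y then 1 else 0), fun s hs => ?_⟩
  have hgs : g s = ∑ x, (g fun y => if x = y then 1 else 0) * s x := by
    rw [LinearMap.pi_apply_eq_sum_univ g s]
    refine Finset.sum_congr rfl fun x _ => ?_
    rw [smul_eq_mul, mul_comm]
  have hφs : φ ⟨s, (hW s).mpr hs⟩ = g s := by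
    have := LinearMap.congr_fun hg ⟨s, (hW s).mpr hs⟩
    simpa using this.symm
  rw [← hgs, ← hφs]
  exact hφ₀ ⟨s, (hW s).mpr hs⟩

end Characters

/-! ### §4 Transport of the lift equation through a constant base change -/

section Transport

variable {σ : Type*} [Fintype σ] [DecidableEq σ] {m : ℕ}

/-- If `B(γ·x) = (P D₁ P') · B · (Q D₂ Q')` with `P' P = 1 = Q' Q` and diagonal `D₁, D₂`, then the conjugated matrix
`B' = P' · B · Q` satisfies `B'(γ·x)_{ij} = (D₁)_i (D₂)_j · B'_{ij}`. [folklore] -/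
theorem linSubst_conj_entry (γ : GL σ ℂ) (B : Matrix (Fin m) (Fin m) (MvPolynomial σ ℂ))
    (P P' Q Q' : Matrix (Fin m) (Fin m) ℂ) (hP : P' * P = 1) (hQ : Q' * Q = 1) (d₁ d₂ : Fin m → ℂ)
    (h : Matrix.linSubstEntries γ B =
      (P * Matrix.diagonal d₁ * P').map C * B * (Q * Matrix.diagonal d₂ * Q').map C) (i j : Fin m) :
    linSubst σ ℂ (γ : Matrix σ σ ℂ) ((P'.map C * B * Q.map C : Matrix (Fin m) (Fin m) (MvPolynomial σ ℂ)) i j) =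
      (d₁ i * d₂ j) • (P'.map C * B * Q.map C : Matrix (Fin m) (Fin m) (MvPolynomial σ ℂ)) i j := by
  -- the conjugated lift equation, as a matrix identity
  have hmat : Matrix.linSubstEntries γ (P'.map C * B * Q.map C) =
      (Matrix.diagonal d₁).map C * (P'.map C * B * Q.map C) * (Matrix.diagonal d₂).map C := by
    have e1 : (P'.map C : Matrix (Fin m) (Fin m) (MvPolynomial σ ℂ)) * (P * Matrix.diagonal d₁ * P').map C =
        (Matrix.diagonal d₁).map C * P'.map C := by
      rw [← Matrix.map_mul, ← Matrix.map_mul, ← Matrix.mul_assoc, ← Matrix.mul_assoc, hP, Matrix.one_mul]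
    have e2 : ((Q * Matrix.diagonal d₂ * Q').map C : Matrix (Fin m) (Fin m) (MvPolynomial σ ℂ)) * Q.map C =
        Q.map C * (Matrix.diagonal d₂).map C := by
      rw [← Matrix.map_mul, ← Matrix.map_mul, Matrix.mul_assoc, Matrix.mul_assoc, hQ, Matrix.mul_one]
    rw [Matrix.linSubstEntries_mul, Matrix.linSubstEntries_mul, Matrix.linSubstEntries_map_C,
      Matrix.linSubstEntries_map_C, h]
    calc P'.map C * ((P * Matrix.diagonal d₁ * P').map C * B * (Q * Matrix.diagonal d₂ * Q').map C) * Q.map C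
        = (P'.map C * (P * Matrix.diagonal d₁ * P').map C) * B * ((Q * Matrix.diagonal d₂ * Q').map C * Q.map C) := by
          simp only [Matrix.mul_assoc]
      _ = ((Matrix.diagonal d₁).map C * P'.map C) * B * (Q.map C * (Matrix.diagonal d₂).map C) := by rw [e1, e2]
      _ = (Matrix.diagonal d₁).map C * (P'.map C * B * Q.map C) * (Matrix.diagonal d₂).map C := by
          simp only [Matrix.mul_assoc]
  have hentry := congr_fun (congr_fun hmat i) j
  rw [Matrix.linSubstEntries_apply] at hentry
  rw [hentry, Matrix.diagonal_map (map_zero C), Matrix.diagonal_map (map_zero C), Matrix.mul_diagonal,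
    Matrix.diagonal_mul, smul_eq_C_mul, map_mul]
  ring

end Transport

end Summit.ValiantsHypothesis.ValiantsHypothesis.Theorems.FreeSubtorusOrbitDimensionBound.SignCovering
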